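import Literature.Claims.NS.ClayVariants
import HarnessLib

/-!
# Claim skeleton: Dou (2026b), «Non-Existence of Global Smooth Solutions to the 3D Navier–Stokes
# Equations in a Periodic Domain with Prescribed Body Force» (Preprints.org 202606.0089 v1)

Cell `ns-claims` (D-0090 NS-CLAIMS SWEEP), claim C54b, typist `ns-claims-typist-3` (g2).
UNREFEREED/DISPUTED CLAIM under adjudication — NOTHING in this file asserts a step: every `Step…`
declaration is a `Prop`; the `theorem`s are unfolding lemmas, the kernel composition
`claim_of_steps`, one TRUE algebraic step (`step1_holds`) and the neutral bookkeeping lemma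
`dataInClass_of_solution` (a solution in the printed class restricts, at `t = 0`, to a periodic
`C¹` extension of the printed profile — the paper's own property 4). Refutations go summit-side
(`Theorems/SoloRefuteDou2026b.lean`).

Version of record (pinned by ns-claims-lit-1 g5, `pub/ns-claims/sources/Dou2026b/LOCATORS.md`):
Hua-Shu Dou, Preprints.org 202606.0089 **v1** (2 June 2026, only version, CC BY, NOT peer-reviewed;
18 PDF pp. = cover + 17 printed), doi:10.20944/preprints202606.0089.v1 [Dou2026b]. LOCATORS ARE
PRINTED PAGES («N of 17»; PDF page N+1) and printed equation/theorem numbers. Sibling row C54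
`Dou2026` (plane Poiseuille) uses the same mechanism; not typed here.

## Claimed statement (as printed, Theorem 6.2, print p.12–13)

«Theorem 6.2 (Global Smooth Solutions Do Not Exist). Consider the 3D incompressible Navier–Stokes
equations in the periodic rectangular domain, Ω = (0, Lx) × (−h, h) × (−h, h). with prescribed
body force, F = (12µb y²/h⁴, 0, 0)ᵀ, initial data, u₀ = (a(1 − y²/h₁²) + b(1 − y⁴/h₁⁴), 0, 0)ᵀ,
h₁ = 1.10h. Then, for Re > Re_cr, there does NOT exist a global smooth solution defined in
Eqs.(6), (7) and (8), u ∈ C([0,∞); H³_{σ,per}(Ω)) ∩ L²_loc([0,∞); H⁴(Ω)) satisfying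
‖∇u(t)‖_{L∞(Ω)} < ∞, ∀t ≥ 0. H³(Ω) ↪ C¹(Ω).» Abstract p.1 and §8 p.15: «This study resolves
the problem statement (D) in Fefferman (2006).» Setting (print p.3–5): periodic box (1)–(3) with a
pressure DROP `p(0,y,z,t) = p(Lx,y,z,t) + p_Lx` (3); H^k_per = «closure of all smooth periodic
functions on Ω with finite H^k-norm» (4), H^k_{σ,per} (5); equations (9) (density ρ, µ = ρν);
force (10); data (11)–(13) with the printed properties «1. u₀ ∈ C^∞(Ω̄) … 3. u_x > 0 everywhere in
Ω. 4. u₀ ∈ H³_{σ,per}(Ω) …»; Re = 2U_{x0}h/ν with U_{x0} the average of the initial profile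
(p.5); «The range of the Reynolds number considered in this study is Re > Re_cr» (p.6), Re_cr NOT
given a value («can be obtained … (see Zhou et al. 2024)»).

TYPED (`ClaimedTheorem Recr`, the unspecified threshold carried as a PARAMETER; `ClaimedTheoremE`
the existential reading): after dividing (9) by ρ (pressure `p/ρ`, force `F/ρ = 12νb y²/h⁴ e_x`),
for all `ν, h, Lx > 0`, all `a, b` with the printed property 3 (profile positive on `[−h,h]`), all
pressure drops, `Re > Recr` ⇒ there is NO `(u, p)` with: `u, p` jointly smooth on `ℝ³ × [0,∞)`
solving the forced equations classically (`IsClassicalNSSolutionOn (Ici 0)`, the tree's notion,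
force slot = the printed `F/ρ`), `u(t)` periodic for the box lattice `Lx ℤ × 2h ℤ × 2h ℤ` and `p(t)`
periodic up to the drop (3) for every `t ≥ 0`, `sup|∇u(t)| < ∞` (7), and `u(·,0) = u₀` ON THE BOX
(9). RENDERING (Δ5, declared): the printed class (6) is `H³_{σ,per}`-valued continuous in time;
it is rendered by the smooth periodic class (the class of Clay (B)/(D) and of every sibling
skeleton) — a SMALLER class, so the typed non-existence is WEAKER than (implied by) the printed one;
the data requirement at `t = 0` is kept exactly as printed («u(x,0) = u₀(x), x ∈ Ω» with `u(0)` in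
the periodic class), which is where the paper's property 4 enters (`Step2_dataInClass`).

## Clay delta (reference `ClayVariants.lean`; nearest: printed (D) `clayPeriodic.Breakdown`)

Δ1 DOMAIN: period box `(0,Lx)×(−h,h)²`, lattice `Lx ℤ × 2h ℤ × 2h ℤ`, not `ℤ³` (a common period
only if `Lx = 2h`; `Literature/Claims/NS/ClayPeriodScalingBridge` rescales ONE common period) ·
Δ3 PRESSURE: affine-plus-periodic (drop `p_Lx` per x-period = an extra constant force not in F) ·
Δ3 FORCE: `F = 12µb y²/h⁴ e_x` is time-independent (no time decay, printed (D) (9)) and its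
2h-periodic extension in y is Lipschitz, not C¹ — not a smooth force on the torus · Δ4 DATA: `u₀`
(13) with `h₁ = 1.1h` is even in y with `∂_y u₀(±h) = ∓(2a/h₁² + 4bh²/h₁⁴)h ≠ 0` under property 3,
so its 2h-periodic extension is NOT C¹: `u₀ ∉ H²_per ⊋ H³_{σ,per}` — the printed property 4 and
the class membership `u(0) ∈ H³_{σ,per}` fail; not a smooth periodic Clay datum (8) · Δ5 class:
see RENDERING · Δ6 conclusion form: ∃-data non-existence — matches (D)'s shape · Δ7: one fixed ν;
«Re > Re_cr» with a free threshold. CONSEQUENCE: `clay_of_claimed : ClaimedTheorem Recr →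
clayPeriodic.Breakdown` is NOT provable -- DELTA: the witness (u₀, F) is not in Clay's smooth
periodic data/force classes (Δ3, Δ4) and the lattice is not ℤ³ (Δ1); moreover Δ4 makes the typed
(and the printed) Theorem 6.2 hold VACUOUSLY (no field of the class has these initial values —
`dataInClass_of_solution` + the refuter's `¬ Step2_dataInClass`), so the statement itself must not
be a kill target; the steps are.

## Steps, in the dependency order of the printed proof (paper item · print page · flag)

* Step 1 = `Step1_steadyProfile` — §3.2.1 (11) p.5 («For steady flow … an exact solution u_x(y) =
  a(1 − y²/h²) + b(1 − y⁴/h⁴), a = −(1/2µ)(∂p/∂x)h²»): the profile with `h` solves the steady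
  x-momentum balance `ν u″ + 12νb y²/h⁴ + 2νa/h² = 0` — true (`step1_holds`).
* Step 2 = `Step2_dataInClass` — §3.2.1 property 4 p.5 «u₀ ∈ H³_{σ,per}(Ω)» with the boundary
  conditions (3) p.3 («u(x,−h,z,t) = u(x,h,z,t), ∂_y u(x,−h,z,t) = ∂_y u(x,h,z,t)») and
  «u(x,0) = u₀(x)» (9), at the `C¹` grain the paper's own embedding (8) `H³ ↪ C¹` gives: the
  y-profile of (13) has a 2h-periodic `C¹` extension off `(−h, h)`. Typist's flag: known-false
  pattern (the profile is even with non-zero slope at `±h`). Every solution of the typed problem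
  yields it (`dataInClass_of_solution`), so its failure makes Theorem 6.2 vacuously true.
* Step 3 = `Step3_meanFlowDominance` — §4.3 (19) p.6 («For laminar evolution before singularity:
  ‖U‖_{H³} ≫ ‖v‖_{H³}, inf_Ω U ≥ C₀ > 0. The mean flow is bounded away from zero due to the
  sustained body force …»), with the time average (15)–(16), at the grain Theorem 6.1 item 2 (39)
  consumes it: pointwise `|U| ≥ C₀ > 0` and `|v| < |U|`. Typist's flag: asserted (unfilled gap);
  vacuous over the (empty, Step 2) class of solutions.
* Step 4 = `Step4_thm51` — Theorem 5.1 (20) p.7 with its proof items 1–5 p.7–8: for every solution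
  with `Re > Re_cr` there are a finite `t* > 0`, an interior `x*` and `ε > 0` with
  `‖νΔu(·,t) + F/ρ‖_{H¹(B_ε(x*))} → 0` as `t → t*`, at a time where `∂u/∂t = 0` («at the extreme
  point of disturbance», used by Theorem 6.1 item 1 and Definition 6.1 p.10). Items 2–3
  («Disturbance Amplification … grow without bound as t → t*» (22); «by the Intermediate Value
  Theorem (or the Borsuk–Ulam type argument …) there must exist … x*, t*» (23)) are asserted;
  item 5 is typed separately as `Step4e_pointwiseToH1` (general form, p.8 top: «By the continuity of
  the H¹-norm and the pointwise convergence established above, the local H¹-norm of the sum tends to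
  zero») — known-false pattern (a smooth field vanishing at one point need not be H¹(B_ε)-small).
* Step 6 = `Step6_EVMP` — Theorem 5.3 (EVMP) p.9, (28) ⇒ (29) via (30)–(33) p.9–10: «at any point
  (x,t) … if ∂u/∂t = 0 and µ∆u + (F·τ)τ = 0, then ∇E cos α = 0 and further the velocity must
  vanish: |u(x,t)| = 0», `τ = u/|u|`. Typed in the generality its proof argues ((30)–(31) are the
  momentum equation of ANY smooth forced flow projected on the streamline; «the only solution to the
  Navier–Stokes equations (given that the flow is viscous) is |u| = 0» (33)); the restriction to the
  printed flow is `Step6P_EVMP_printed` (`step6P_of_step6`; vacuous by Step 2). Typist's flag: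
  known-false pattern (any steady shear flow with `µΔu + (F·τ)τ = 0` and `u ≠ 0`: plane Couette
  `u = y e_x`, `F = 0`; or the steady member `u = b(1 − y⁴/h⁴)e_x` of the printed family with the
  printed `F` and zero pressure drop).
* `LocalVanishing` + Step 8a = `Step8a_inference` — Theorem 6.1 proof item 1 p.11 («By EVMP
  (Theorem 5.3) with lim ‖S‖_{H¹(B_ε(x*))} = 0 and ∂u/∂t = 0 …, lim ‖u‖_{H³(B_ε(x*))} = 0 … the
  velocity field vanishes almost everywhere in B_ε(x*). In particular … u(x*,t*) = 0» (38)): the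
  printed inference `EVMP → LocalVanishing`; `LocalVanishing` itself (general form) is a known-false
  pattern (Couette again: `S ≡ 0`, steady, `u ≠ 0`).
* Step 9 = `Step9_gradientBlowup` — §6.2 (41)–(42) p.12 («|∂u_x/∂y(x*,t*)| = |lim_{t↗t*} u(x*,t) −
  lim_{t↘t*} u(x*,t)|/ε ≥ δ/ε → ∞»): a time-jump read as a spatial derivative; for a continuous
  field the premises are contradictory — vacuous; downstream of the contradiction (38)/(39), not
  consumed by `claim_of_steps`.
Not typed: Theorem 5.2 p.8–9 (position of the vanishing point via the «energy gradient function»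
K (26), numerics (27)) — only «interior point» is used, carried inside Step 4; Lemma 5.1 (BKM) p.10
and (43)–(45) p.12 (classical; tree `Literature.Analysis.FluidPDE.NSVorticityBKM`), §7–§8.
Ordered index (TYPING-HYGIENE 11): 1 → 2 → 3 → 4 (4e) → 6 → 8a → 9 → Thm 6.2; `claim_of_steps`
consumes 3, 4, 6, 8a (the contradiction (38) vs (39) of Theorem 6.1 items 1–3, p.11).

## KERNEL COMPOSITION: Step 3 → Step 4 → Step 6 → Step 8a → ClaimedTheorem — PROVED
(`claim_of_steps`: a global solution would have, at the `(x*, t*)` of Theorem 5.1, `u = 0` on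
`B_ε(x*)` by EVMP/item 1 and `|u(x*,t*)| ≥ |U| − |v| > 0` by (19)/(39)). No LOGIC gap at this
grain; the gaps are INSIDE Steps 3 and 4 (asserted) and the falsity in Steps 2, 4e, 6, 8a.

WHAT THIS IS NOT: not a claim about NS regularity or blow-up; not a claim about any author beyond the
typed locator.
-/

noncomputable section

open Set Function Filter MeasureTheory
open scoped Topology ENNReal NNReal ContDiff Laplacian

namespace Literature.Claims.NS.Dou2026b

open Literature.Analysis.FluidPDE

/-! ## The printed objects (print p.3–6), after division of (9) by ρ -/

/-- Coordinate unit vectors `e_x, e_y, e_z` of ℝ³ (coordinates `x 0 = x`, `x 1 = y`, `x 2 = z`). [folklore] -/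
def e (i : Fin 3) : EuclideanSpace ℝ (Fin 3) := EuclideanSpace.single i (1 : ℝ)

/-- The printed velocity profile (11)/(13): `a(1 − y²/h₁²) + b(1 − y⁴/h₁⁴)` (with `h₁ = h` in the
steady solution (11), `h₁ = 1.10h` in the datum (13)). [cite: Dou2026b, eqs. (11)–(13) print p.5] -/
def profile (a b h₁ : ℝ) (y : ℝ) : ℝ := a * (1 - y ^ 2 / h₁ ^ 2) + b * (1 - y ^ 4 / h₁ ^ 4)

/-- `h₁ = 1.10 h` (13). [cite: Dou2026b, eq. (13) print p.5] -/
def hOne (h : ℝ) : ℝ := 11 / 10 * h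

/-- The printed datum (13): `u₀(x) = (a(1 − y²/h₁²) + b(1 − y⁴/h₁⁴), 0, 0)ᵀ`, `h₁ = 1.10h`, as a
field on ℝ³ (the formula; its restriction to the box is the datum of (9)). [cite: Dou2026b, eq. (13) print p.5] -/
def datum (a b h : ℝ) (x : EuclideanSpace ℝ (Fin 3)) : EuclideanSpace ℝ (Fin 3) :=
  profile a b (hOne h) (x 1) • e 0

/-- The printed body force per unit mass, `F/ρ = (12νb y²/h⁴, 0, 0)ᵀ` ((10) with `µ = ρν`),
time-independent. [cite: Dou2026b, eq. (10) print p.4] -/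
def force (ν b h : ℝ) (_t : ℝ) (x : EuclideanSpace ℝ (Fin 3)) : EuclideanSpace ℝ (Fin 3) :=
  (12 * ν * b * (x 1) ^ 2 / h ^ 4) • e 0

/-- The open box `Ω = (0, Lx) × (−h, h) × (−h, h)` (1). [cite: Dou2026b, eq. (1) print p.3] -/
def box (Lx h : ℝ) : Set (EuclideanSpace ℝ (Fin 3)) :=
  {x | 0 < x 0 ∧ x 0 < Lx ∧ -h < x 1 ∧ x 1 < h ∧ -h < x 2 ∧ x 2 < h}

/-- Periodicity for the box lattice `Lx ℤ × 2h ℤ × 2h ℤ` (the velocity rows of (3)).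
[cite: Dou2026b, eq. (3) print p.3] -/
def IsBoxPeriodic {F : Type*} (Lx h : ℝ) (w : EuclideanSpace ℝ (Fin 3) → F) : Prop :=
  ∀ x, w (x + Lx • e 0) = w x ∧ w (x + (2 * h) • e 1) = w x ∧ w (x + (2 * h) • e 2) = w x

/-- The pressure rows of (3): periodic in `y, z`, periodic UP TO THE DROP `p_Lx` in `x`
(`p(0,y,z,t) = p(Lx,y,z,t) + p_Lx`). [cite: Dou2026b, eq. (3) print p.3] -/
def IsPressurePeriodic (Lx h pdrop : ℝ) (q : EuclideanSpace ℝ (Fin 3) → ℝ) : Prop :=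
  ∀ x, q (x + Lx • e 0) = q x - pdrop ∧ q (x + (2 * h) • e 1) = q x ∧ q (x + (2 * h) • e 2) = q x

/-- The cross-section average of the initial profile, `U_{x0} = (1/2h)∫_{−h}^{h} u₀ₓ dy =
a(1 − h²/(3h₁²)) + b(1 − h⁴/(5h₁⁴))`. [cite: Dou2026b, §3.2.2 print p.5] -/
def meanVelocity (a b h : ℝ) : ℝ :=
  a * (1 - h ^ 2 / (3 * hOne h ^ 2)) + b * (1 - h ^ 4 / (5 * hOne h ^ 4))

/-- The Reynolds number `Re = 2 U_{x0} h / ν`. [cite: Dou2026b, §3.2.2 print p.5] -/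
def reynolds (ν a b h : ℝ) : ℝ := 2 * meanVelocity a b h * h / ν

/-- **A solution of the printed problem on the time set `S` (rendered class).** `(u, p)` (pressure
and force divided by ρ) is a classical solution of the forced equations (9) on `ℝ³ × S` in the
tree's sense (`IsClassicalNSSolutionOn`: jointly smooth, momentum equation with force `F/ρ`,
divergence free), `u(t)` box-periodic and `p(t)` periodic up to the drop (3) for `t ∈ S`,
`sup_x |∇u(t)| < ∞` (7), and `u(·,0) = u₀` on the box Ω (9). RENDERING of the printed class (6)–(8)
(`C([0,∞); H³_{σ,per}) ∩ L²_loc H⁴`, (7)) by the smooth periodic class — see the module docstring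
(Δ5). [cite: Dou2026b, eqs. (3), (6)–(9), (10), (13) print p.3–5] -/
structure IsRenderedSolutionOn (S : Set ℝ) (ν a b h Lx pdrop : ℝ)
    (u : ℝ → EuclideanSpace ℝ (Fin 3) → EuclideanSpace ℝ (Fin 3))
    (p : ℝ → EuclideanSpace ℝ (Fin 3) → ℝ) : Prop where
  ns : IsClassicalNSSolutionOn S ν (force ν b h) u p
  periodic_velocity : ∀ t ∈ S, IsBoxPeriodic Lx h (u t)
  periodic_pressure : ∀ t ∈ S, IsPressurePeriodic Lx h pdrop (p t)
  gradient_bounded : ∀ t ∈ S, ∃ M : ℝ, ∀ x, ‖fderiv ℝ (u t) x‖ ≤ M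
  initial : ∀ x ∈ box Lx h, u 0 x = datum a b h x

/-! ## The claimed statement (Theorem 6.2, print p.12–13) -/

/-- **THEOREM 6.2 as printed (rendered class), the unspecified critical Reynolds number `Re_cr`
carried as the parameter `Recr`**: for all `ν, h, Lx > 0`, all profile parameters `a, b` with the
printed property 3 («u_x > 0 everywhere in Ω», here on the closed y-range), every pressure drop,
`Re > Recr` ⇒ no solution of the printed problem on `[0, ∞)` in the class.
[cite: Dou2026b, Theorem 6.2 print p.12–13; property 3 print p.5; «Re > Re_cr» print p.6] -/
def ClaimedTheorem (Recr : ℝ) : Prop :=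
  ∀ (ν h Lx a b pdrop : ℝ), 0 < ν → 0 < h → 0 < Lx →
    (∀ y ∈ Icc (-h) h, 0 < profile a b (hOne h) y) → Recr < reynolds ν a b h →
      ¬ ∃ (u : ℝ → EuclideanSpace ℝ (Fin 3) → EuclideanSpace ℝ (Fin 3))
          (p : ℝ → EuclideanSpace ℝ (Fin 3) → ℝ), IsRenderedSolutionOn (Ici 0) ν a b h Lx pdrop u p

/-- The existential reading of «for Re > Re_cr» (a critical value exists). [cite: Dou2026b, Theorem 6.2 print p.12–13 with §3.2.2 print p.5–6] -/
def ClaimedTheoremE : Prop :=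
  ∃ Recr : ℝ, ClaimedTheorem Recr

/-- Monotonicity in the threshold. [cite: Dou2026b, Theorem 6.2 print p.12–13] -/
theorem ClaimedTheorem.mono {R R' : ℝ} (h : ClaimedTheorem R) (hRR' : R ≤ R') : ClaimedTheorem R' :=
  fun ν hh Lx a b pdrop hν hh' hLx hpos hRe => h ν hh Lx a b pdrop hν hh' hLx hpos (lt_of_le_of_lt hRR' hRe)

/-! ## The steps -/

/-- **Step 1 — (11) print p.5**: «For steady flow, the governing equations and the boundary
conditions in a two-dimensional channel with no-slip boundary conditions gives an exact solution,
u_x(y) = a(1 − y²/h²) + b(1 − y⁴/h⁴) (11) where … a = −(1/2µ)(∂p/∂x)h²»: the profile with `h`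
balances viscosity, the force (10) and the constant pressure gradient: `ν P″(y) + 12νb y²/h⁴ +
2νa/h² = 0`. True (`step1_holds`). [cite: Dou2026b, eq. (11) print p.5 with (10) print p.4] -/
def Step1_steadyProfile : Prop :=
  ∀ (ν a b h y : ℝ), h ≠ 0 →
    ν * deriv (deriv (profile a b h)) y + 12 * ν * b * y ^ 2 / h ^ 4 + 2 * ν * a / h ^ 2 = 0

/-- **Step 2 — property 4 print p.5 («u₀ ∈ H³_{σ,per}(Ω)») with (3) print p.3 and «u(x,0) = u₀(x)»
(9), at the C¹ grain of the embedding (8)**: for the printed parameters (property 3), the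
y-profile of the datum (13) is the restriction to `(−h, h)` of a 2h-periodic `C¹` function.
Typist's flag: known-false pattern (the profile is even in y with slope `∓(2a/h₁² + 4bh²/h₁⁴)h ≠ 0`
at `y = ±h`). [cite: Dou2026b, §3.2.1 property 4 print p.5; eq. (3) print p.3; eq. (9) print p.4] -/
def Step2_dataInClass : Prop :=
  ∀ (a b h : ℝ), 0 < h → (∀ y ∈ Icc (-h) h, 0 < profile a b (hOne h) y) →
    ∃ g : ℝ → ℝ, ContDiff ℝ 1 g ∧ (∀ y, g (y + 2 * h) = g y) ∧
      ∀ y ∈ Ioo (-h) h, g y = profile a b (hOne h) y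

/-- The time average (15): `U(x,t) = (1/Δt) ∫_{t−Δt/2}^{t+Δt/2} u(x,τ) dτ` («Δt ≫ τ_d, Δt ≪ t*»
— the window is a free parameter). [cite: Dou2026b, eq. (15) print p.6] -/
def meanFlow (Δt : ℝ) (u : ℝ → EuclideanSpace ℝ (Fin 3) → EuclideanSpace ℝ (Fin 3)) (t : ℝ)
    (x : EuclideanSpace ℝ (Fin 3)) : EuclideanSpace ℝ (Fin 3) :=
  (1 / Δt) • ∫ τ in (t - Δt / 2)..(t + Δt / 2), u τ x

/-- **Step 3 — §4.3 (19) print p.6, at the grain Theorem 6.1 item 2 (39) print p.11 uses it**: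
«For laminar evolution before singularity: ‖U‖_{H³(Ω)} ≫ ‖v‖_{H³(Ω)}, inf_Ω U ≥ C₀ > 0. The mean
flow is bounded away from zero due to the sustained body force and the setting up of the velocity
at the boundaries.» with (39) «‖U‖_{L∞} ≥ C₀ > 0, ‖v‖_{L∞} ≪ ‖U‖_{L∞}. Thus, ‖u‖_{L∞} ≥ ‖U‖_{L∞} −
‖v‖_{L∞} > 0»: for every solution and every averaging window there is `C₀ > 0` with `|U(x,t)| ≥
C₀` and `|v(x,t)| < |U(x,t)|` at every point and time (`v = u − U` (16)). Typist's flag: asserted,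
no proof offered (unfilled gap). ERRATUM (2026-08-27, ns-claims-typist-3 g5, chair RULINGS 09:34Z (3) —
docstring only, the `def` is byte-unchanged): the earlier gloss «vacuous over the typed class by Step 2»
was INACCURATE — this display quantifies over all `(a, b)` WITHOUT the printed property 3 (positivity of
the profile) under which Step 2 empties the class, and at `a = b = p_Lx = 0` the rest state is a rendered
solution with mean flow `0`, so the display is KERNEL-FALSE as typed
(`Summit.…Theorems.Dou2026bStep3.not_Step3_meanFlowDominance`, p519813; off the composition path of #67).
[cite: Dou2026b, eq. (19) print p.6; eq. (39) print p.11] -/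
def Step3_meanFlowDominance : Prop :=
  ∀ (ν h Lx a b pdrop : ℝ) (u : ℝ → EuclideanSpace ℝ (Fin 3) → EuclideanSpace ℝ (Fin 3))
    (p : ℝ → EuclideanSpace ℝ (Fin 3) → ℝ), 0 < ν → 0 < h → 0 < Lx →
    IsRenderedSolutionOn (Ici 0) ν a b h Lx pdrop u p →
      ∀ Δt : ℝ, 0 < Δt → ∃ C₀ : ℝ, 0 < C₀ ∧ ∀ t : ℝ, 0 ≤ t → ∀ x,
        C₀ ≤ ‖meanFlow Δt u t x‖ ∧ ‖u t x - meanFlow Δt u t x‖ < ‖meanFlow Δt u t x‖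

/-- The local `H¹(B_ε(c))` energy `∫_{B_ε(c)} (|w|² + |∇w|²)` of a field (squared norm in (20),
(35), (37)). [cite: Dou2026b, eq. (20) print p.7] -/
def h1LocalSq (w : EuclideanSpace ℝ (Fin 3) → EuclideanSpace ℝ (Fin 3)) (c : EuclideanSpace ℝ (Fin 3))
    (ε : ℝ) : ℝ :=
  ∫ x in Metric.ball c ε, (‖w x‖ ^ 2 + ‖fderiv ℝ w x‖ ^ 2)

/-- **Step 4 — THEOREM 5.1 (20) print p.7 (with proof items 1–5 p.7–8 and the «∂u/∂t = 0 at the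
extreme point of disturbance» clause of Definition 6.1 p.10 / Theorem 6.1 item 1 p.11)**: «for
Re > Re_cr, suppose u … is a local smooth solution … Then, there exists a finite time t* > 0 and
an interior point x* ∈ Ω such that lim_{t→t*} ‖ν∆u(·,t) + (1/ρ)F(·,t)‖_{H¹(B_ε(x*))} = 0. (20)»,
typed over solutions on `[0,∞)` (the case `claim_of_steps` needs), delivering also `∂u/∂t(x*,t*) =
0`. Items 2–3 of the proof are asserted («Disturbance Amplification … grow without bound as t →
t*» (22); IVT/«Borsuk–Ulam type argument» (23)); item 5 is `Step4e_pointwiseToH1`. Typist's flag: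
unfilled gap; vacuous over the typed class by Step 2. [cite: Dou2026b, Theorem 5.1 eq. (20) and proof items 1–5 print p.7–8; Definition 6.1 print p.10] -/
def Step4_thm51 (Recr : ℝ) : Prop :=
  ∀ (ν h Lx a b pdrop : ℝ) (u : ℝ → EuclideanSpace ℝ (Fin 3) → EuclideanSpace ℝ (Fin 3))
    (p : ℝ → EuclideanSpace ℝ (Fin 3) → ℝ), 0 < ν → 0 < h → 0 < Lx →
    (∀ y ∈ Icc (-h) h, 0 < profile a b (hOne h) y) → Recr < reynolds ν a b h →
    IsRenderedSolutionOn (Ici 0) ν a b h Lx pdrop u p →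
      ∃ tstar : ℝ, 0 < tstar ∧ ∃ xstar ∈ box Lx h, ∃ ε : ℝ, 0 < ε ∧
        Tendsto (fun t => h1LocalSq (fun x => ν • (Δ (u t)) x + force ν b h t x) xstar ε)
          (𝓝[<] tstar) (𝓝 0) ∧
        timeDerivWithin (Ici 0) u tstar xstar = 0

/-- **Step 4e — Theorem 5.1 proof item 5, print p.8 (general form)**: «Limit in H¹-norm: By the
continuity of the H¹-norm and the pointwise convergence established above, the local H¹-norm of
the sum tends to zero»: a jointly continuous field with continuous spatial derivative that VANISHES
AT ONE POINT `(x*, t*)` has `H¹(B_ε(x*))`-energy tending to `0` as `t → t*`, for every `ε > 0`.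
Typist's flag: known-false pattern (`S(t,x) = x − x*`). [cite: Dou2026b, Theorem 5.1 proof item 5 print p.8] -/
def Step4e_pointwiseToH1 : Prop :=
  ∀ (S : ℝ → EuclideanSpace ℝ (Fin 3) → EuclideanSpace ℝ (Fin 3)) (tstar : ℝ)
    (xstar : EuclideanSpace ℝ (Fin 3)),
    ContDiff ℝ 1 (uncurry S) → S tstar xstar = 0 →
      ∀ ε : ℝ, 0 < ε → Tendsto (fun t => h1LocalSq (S t) xstar ε) (𝓝 tstar) (𝓝 0)

/-- **Step 6 — THEOREM 5.3 (EVMP), (28) ⇒ (29) print p.9, proof (30)–(33) print p.9–10, in the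
generality the proof argues**: «at any point (x,t) ∈ Ω × (0,∞), if ∂u/∂t = 0 and µ∆u + (F·τ)τ =
0, (28) then ∇E cos α = 0. and further the velocity must vanish: |u(x,t)| = 0. (29) where τ = u/|u|
is the unit tangent vector along the streamline … defined … when u ≠ 0», proof: Lamb form (30),
streamline projection «ρ∂u/∂t + ∇E cos α = µ∆u + (F·τ)τ (31)», «If ∂_t u = 0 and µ∆u + (F·τ)τ =
0, then ∇E cos α = 0 (32). Thus, there is no mechanical energy gradient to drive flow along the
streamline direction. Consequently, the only solution to the Navier–Stokes equations (given that
the flow is viscous) is |u(x,t)| = 0 (33)». Typed (after division by ρ): for every classical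
forced solution on a time set `S` with `ν > 0`, at every `(x,t)` with `u(x,t) ≠ 0`, `∂_t u(x,t) =
0` and `νΔu(x,t) + ⟨f(x,t), τ⟩τ = 0` imply `u(x,t) = 0`. Typist's flag: known-false pattern (plane
Couette `u = y e_x`, `f = 0`, `p = const`; or the steady quartic member of the printed family).
[cite: Dou2026b, Theorem 5.3 eqs. (28)–(33) print p.9–10] -/
def Step6_EVMP : Prop :=
  ∀ (S : Set ℝ) (ν : ℝ) (f u : ℝ → EuclideanSpace ℝ (Fin 3) → EuclideanSpace ℝ (Fin 3))
    (p : ℝ → EuclideanSpace ℝ (Fin 3) → ℝ), 0 < ν → IsClassicalNSSolutionOn S ν f u p →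
    ∀ t ∈ S, ∀ x, u t x ≠ 0 → timeDerivWithin S u t x = 0 →
      ν • (Δ (u t)) x + (inner ℝ (f t x) (‖u t x‖⁻¹ • u t x)) • (‖u t x‖⁻¹ • u t x) = 0 →
        u t x = 0

/-- **Step 6, restricted to the printed flow** («For the 3D incompressible flow satisfying Eqs.(1)
to (3), (9), (10) and (13)»): the same at points of a solution of the printed problem on `[0,∞)`.
Implied by the general form (`step6P_of_step6`). ERRATUM (2026-08-27, ns-claims-typist-3 g5, docstring
only): the earlier gloss «vacuous over the typed class by Step 2» presupposed the printed profile
positivity, which the typed class does not carry (see the Step 3 erratum); no countermodel is known from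
the rest state (its antecedent `u ≠ 0` is never met), so this display stays open as typed.
[cite: Dou2026b, Theorem 5.3 print p.9] -/
def Step6P_EVMP_printed : Prop :=
  ∀ (ν h Lx a b pdrop : ℝ) (u : ℝ → EuclideanSpace ℝ (Fin 3) → EuclideanSpace ℝ (Fin 3))
    (p : ℝ → EuclideanSpace ℝ (Fin 3) → ℝ), 0 < ν → 0 < h → 0 < Lx →
    IsRenderedSolutionOn (Ici 0) ν a b h Lx pdrop u p →
    ∀ t : ℝ, 0 ≤ t → ∀ x, u t x ≠ 0 → timeDerivWithin (Ici 0) u t x = 0 →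
      ν • (Δ (u t)) x + (inner ℝ (force ν b h t x) (‖u t x‖⁻¹ • u t x)) • (‖u t x‖⁻¹ • u t x) = 0 →
        u t x = 0

/-- The general EVMP implies its printed restriction. [cite: Dou2026b, Theorem 5.3 print p.9] -/
theorem step6P_of_step6 (h6 : Step6_EVMP) : Step6P_EVMP_printed :=
  fun ν h _ _ b _ u p hν _ _ hsol t ht x hux hdt hS =>
    h6 (Ici 0) ν (force ν b h) u p hν hsol.ns t ht x hux hdt hS

/-- **«LocalVanishing» — the CONSEQUENT of Theorem 6.1 proof item 1, print p.11 (general form)**: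
«with lim_{t→t*} ‖S‖_{H¹(B_ε(x*))} = 0 and ∂u/∂t = 0 …, lim ‖u‖_{H³(B_ε(x*))} = 0. Thus, by
continuity of Sobolev norm, ‖u‖_{H³(B_ε(x*))} = 0. (38) Since the H³-norm is zero, the velocity
field vanishes almost everywhere in B_ε(x*). In particular … u(x*,t*) = 0»: for a classical forced
solution on `[0,∞)`, local H¹-vanishing of `νΔu + f` at `x*` as `t → t*` and `∂_t u(x*,t*) = 0`
force `u(·,t*) = 0` on `B_ε(x*)`. Typist's flag: known-false pattern (Couette: `νΔu + f ≡ 0`,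
steady, `u ≠ 0`). [cite: Dou2026b, Theorem 6.1 proof item 1 eq. (38) print p.11] -/
def LocalVanishing : Prop :=
  ∀ (ν : ℝ) (f u : ℝ → EuclideanSpace ℝ (Fin 3) → EuclideanSpace ℝ (Fin 3))
    (p : ℝ → EuclideanSpace ℝ (Fin 3) → ℝ), 0 < ν → IsClassicalNSSolutionOn (Ici 0) ν f u p →
    ∀ tstar : ℝ, 0 < tstar → ∀ (xstar : EuclideanSpace ℝ (Fin 3)) (ε : ℝ), 0 < ε →
      Tendsto (fun t => h1LocalSq (fun x => ν • (Δ (u t)) x + f t x) xstar ε) (𝓝[<] tstar) (𝓝 0) →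
      timeDerivWithin (Ici 0) u tstar xstar = 0 →
        ∀ x ∈ Metric.ball xstar ε, u tstar x = 0

/-- **Step 8a — Theorem 6.1 proof item 1, print p.11, as the printed inference «By EVMP (Theorem
5.3) …»**: `EVMP → LocalVanishing`. (EVMP yields `u = 0` only at points where (28) holds
pointwise; the passage from H¹(B_ε)-smallness of `S` to (28) on the ball, and from there to (38),
is not argued — unfilled gap; as an implication it is vacuously true once EVMP is refuted, so the
refuter addresses `LocalVanishing` directly.) [cite: Dou2026b, Theorem 6.1 proof item 1 print p.11] -/
def Step8a_inference : Prop :=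
  Step6_EVMP → LocalVanishing

/-- **Step 9 — §6.2 (41)–(42) print p.12**: «From Eq.(39), lim_{t↗t*} u(x*,t) = u⁻ > 0 … From
Eq.(38), lim_{t↘t*} u(x*,t) = 0 … |∂u_x/∂y(x*,t*)| = |lim_{t↗t*} u − lim_{t↘t*} u|/ε ≥ δ/ε → ∞,
ε → 0 (41) … lim_{t→t*} ‖∇u(t)‖_{L∞} = ∞ (42)»: for a solution on `[0,∞)`, if `|u(x*,t)| ≥ δ > 0`
for `t < t*` and `u(x*,t*) = 0` then `∇u(t*)` is unbounded. Typist's flag: for a (continuous)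
classical solution the premises are contradictory — vacuous; downstream restatement, not consumed
by `claim_of_steps`. [cite: Dou2026b, §6.2 eqs. (40)–(42) print p.11–12] -/
def Step9_gradientBlowup : Prop :=
  ∀ (ν h Lx a b pdrop : ℝ) (u : ℝ → EuclideanSpace ℝ (Fin 3) → EuclideanSpace ℝ (Fin 3))
    (p : ℝ → EuclideanSpace ℝ (Fin 3) → ℝ), IsRenderedSolutionOn (Ici 0) ν a b h Lx pdrop u p →
    ∀ (tstar : ℝ) (xstar : EuclideanSpace ℝ (Fin 3)), 0 < tstar →
      (∃ δ : ℝ, 0 < δ ∧ ∀ t ∈ Ico 0 tstar, δ ≤ ‖u t xstar‖) → u tstar xstar = 0 →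
        ∀ M : ℝ, ∃ x, M < ‖fderiv ℝ (u tstar) x‖

/-! ## Kernel composition (Theorem 6.1 items 1–3 ⇒ Theorem 6.2) -/

/-- **KERNEL COMPOSITION — Step 3 → Step 4 → Step 6 → Step 8a → ClaimedTheorem.** A solution on
`[0,∞)` would have, at the `(x*, t*, ε)` of Theorem 5.1, `u(·,t*) = 0` on `B_ε(x*)` (EVMP via item
1, (38)) while (19)/(39) give `|u(x*,t*)| ≥ |U| − |u − U| > 0` — the contradiction of Theorem 6.1
item 3; hence no solution (Theorem 6.2). Pure logic plus the triangle inequality; nothing asserted.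
[cite: Dou2026b, Theorem 6.1 proof items 1–3 print p.11; §6.3 print p.12] -/
theorem claim_of_steps (Recr : ℝ) (h3 : Step3_meanFlowDominance) (h4 : Step4_thm51 Recr)
    (h6 : Step6_EVMP) (h8 : Step8a_inference) : ClaimedTheorem Recr := by
  intro ν h Lx a b pdrop hν hh hLx hpos hRe hex
  obtain ⟨u, p, hsol⟩ := hex
  obtain ⟨ts, hts, xs, _, ε, hε, hlim, hdt⟩ := h4 ν h Lx a b pdrop u p hν hh hLx hpos hRe hsol
  have hzero : u ts xs = 0 :=
    h8 h6 ν (force ν b h) u p hν hsol.ns ts hts xs ε hε hlim hdt xs (Metric.mem_ball_self hε)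
  obtain ⟨C₀, hC₀, hdom⟩ := h3 ν h Lx a b pdrop u p hν hh hLx hsol 1 one_pos
  obtain ⟨hU, hv⟩ := hdom ts hts.le xs
  have htri := abs_norm_sub_norm_le (u ts xs) (meanFlow 1 u ts xs)
  have hpos' : 0 < ‖u ts xs‖ := by
    have h1 := (abs_le.mp htri).1
    linarith
  rw [hzero, norm_zero] at hpos'
  exact lt_irrefl _ hpos'

/-- The existential reading follows from any instance. [cite: Dou2026b, Theorem 6.2 print p.12–13] -/
theorem claimedE_of_claimed {Recr : ℝ} (h : ClaimedTheorem Recr) : ClaimedTheoremE := ⟨Recr, h⟩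

/-! ## Bookkeeping: a solution in the class restricts to a periodic C¹ extension of the profile -/

/-- The y-line through `(Lx/2, ·, 0)`: `y ↦ (Lx/2) e_x + y e_y`. [folklore] -/
def yLine (Lx : ℝ) (y : ℝ) : EuclideanSpace ℝ (Fin 3) := (Lx / 2) • e 0 + y • e 1

/-- The x-coordinate of the y-line is `Lx/2`. [cite: Dou2026b, eq. (1) print p.3] -/
theorem yLine_apply_zero (Lx y : ℝ) : yLine Lx y 0 = Lx / 2 := by
  simp [yLine, e]

/-- The y-coordinate of the y-line is `y`. [cite: Dou2026b, eq. (1) print p.3] -/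
theorem yLine_apply_one (Lx y : ℝ) : yLine Lx y 1 = y := by
  simp [yLine, e]

/-- The z-coordinate of the y-line is `0`. [cite: Dou2026b, eq. (1) print p.3] -/
theorem yLine_apply_two (Lx y : ℝ) : yLine Lx y 2 = 0 := by
  simp [yLine, e]

/-- Translating the parameter translates the point along `e_y`. [cite: Dou2026b, eq. (3) print p.3] -/
theorem yLine_add (Lx y s : ℝ) : yLine Lx (y + s) = yLine Lx y + s • e 1 := by
  simp only [yLine, add_smul]; abel

/-- The y-line is smooth (affine). [cite: Dou2026b, eq. (1) print p.3] -/
theorem contDiff_yLine (Lx : ℝ) : ContDiff ℝ ∞ (yLine Lx) :=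
  contDiff_const.add (contDiff_id.smul contDiff_const)

/-- The x-component of the datum (13) is the printed profile. [cite: Dou2026b, eq. (13) print p.5] -/
theorem datum_apply_zero (a b h : ℝ) (x : EuclideanSpace ℝ (Fin 3)) :
    datum a b h x 0 = profile a b (hOne h) (x 1) := by
  simp [datum, e]

/-- **Neutral bookkeeping lemma (the paper's property 4 is forced by its own class)**: a solution of
the printed problem on `[0,∞)` restricts, along the y-line through an interior point at `t = 0`, to
a 2h-periodic `C¹` (indeed smooth) function equal to the printed profile on `(−h, h)` — an instance
of `Step2_dataInClass`'s conclusion. (So a refutation of that instance makes `ClaimedTheorem`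
vacuously true; filed summit-side.) [cite: Dou2026b, §3.2.1 property 4 print p.5 with (3), (6), (9)] -/
theorem dataInClass_of_solution {ν a b h Lx pdrop : ℝ}
    {u : ℝ → EuclideanSpace ℝ (Fin 3) → EuclideanSpace ℝ (Fin 3)} {p : ℝ → EuclideanSpace ℝ (Fin 3) → ℝ}
    (hh : 0 < h) (hLx : 0 < Lx) (hsol : IsRenderedSolutionOn (Ici 0) ν a b h Lx pdrop u p) :
    ∃ g : ℝ → ℝ, ContDiff ℝ 1 g ∧ (∀ y, g (y + 2 * h) = g y) ∧
      ∀ y ∈ Ioo (-h) h, g y = profile a b (hOne h) y := by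
  have h0 : (0 : ℝ) ∈ Ici (0 : ℝ) := self_mem_Ici
  have hu0 : ContDiff ℝ ∞ (u 0) := hsol.ns.contDiff_velocity h0
  refine ⟨fun y => (u 0 (yLine Lx y)) 0, ?_, fun y => ?_, fun y hy => ?_⟩
  · have hc : ContDiff ℝ ∞ (fun y => u 0 (yLine Lx y)) := hu0.comp (contDiff_yLine Lx)
    have hproj : ContDiff ℝ ∞ (fun v : EuclideanSpace ℝ (Fin 3) => v 0) :=
      (EuclideanSpace.proj (0 : Fin 3) : EuclideanSpace ℝ (Fin 3) →L[ℝ] ℝ).contDiff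
    exact (hproj.comp hc).of_le (by norm_cast)
  · show (u 0 (yLine Lx (y + 2 * h))) 0 = (u 0 (yLine Lx y)) 0
    rw [yLine_add, (hsol.periodic_velocity 0 h0 (yLine Lx y)).2.1]
  · show (u 0 (yLine Lx y)) 0 = profile a b (hOne h) y
    have hmem : yLine Lx y ∈ box Lx h := by
      refine ⟨?_, ?_, ?_, ?_, ?_, ?_⟩ <;>
        simp only [yLine_apply_zero, yLine_apply_one, yLine_apply_two] <;> linarith [hy.1, hy.2]
    rw [hsol.initial _ hmem, datum_apply_zero, yLine_apply_one]

/-! ## Discharged TRUE step -/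

/-- The profile's derivative. [cite: Dou2026b, eq. (11) print p.5] -/
theorem hasDerivAt_profile (a b h₁ y : ℝ) :
    HasDerivAt (profile a b h₁) (-(2 * a * y / h₁ ^ 2) - 4 * b * y ^ 3 / h₁ ^ 4) y := by
  have h2 : HasDerivAt (fun x : ℝ => x ^ 2) (2 * y) y := by
    simpa using hasDerivAt_pow 2 y
  have h4 : HasDerivAt (fun x : ℝ => x ^ 4) (4 * y ^ 3) y := by
    simpa using hasDerivAt_pow 4 y
  have hA : HasDerivAt (fun x : ℝ => a * (1 - x ^ 2 / h₁ ^ 2)) (a * (-(2 * y / h₁ ^ 2))) y :=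
    ((h2.div_const (h₁ ^ 2)).const_sub 1).const_mul a
  have hB : HasDerivAt (fun x : ℝ => b * (1 - x ^ 4 / h₁ ^ 4)) (b * (-(4 * y ^ 3 / h₁ ^ 4))) y :=
    ((h4.div_const (h₁ ^ 4)).const_sub 1).const_mul b
  exact (hA.add hB).congr_deriv (by ring)

/-- The profile's derivative as a function. [cite: Dou2026b, eq. (11) print p.5] -/
theorem deriv_profile (a b h₁ : ℝ) :
    deriv (profile a b h₁) = fun y => -(2 * a * y / h₁ ^ 2) - 4 * b * y ^ 3 / h₁ ^ 4 := by
  funext y; exact (hasDerivAt_profile a b h₁ y).deriv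

/-- The profile's second derivative `−2a/h₁² − 12b y²/h₁⁴`. [cite: Dou2026b, eq. (11) print p.5] -/
theorem hasDerivAt_deriv_profile (a b h₁ y : ℝ) :
    HasDerivAt (deriv (profile a b h₁)) (-(2 * a / h₁ ^ 2) - 12 * b * y ^ 2 / h₁ ^ 4) y := by
  rw [deriv_profile]
  have h1 : HasDerivAt (fun x : ℝ => x) 1 y := hasDerivAt_id y
  have h3 : HasDerivAt (fun x : ℝ => x ^ 3) (3 * y ^ 2) y := by
    simpa using hasDerivAt_pow 3 y
  have hA : HasDerivAt (fun x : ℝ => -(2 * a * x / h₁ ^ 2)) (-(2 * a * 1 / h₁ ^ 2)) y :=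
    ((h1.const_mul (2 * a)).div_const (h₁ ^ 2)).neg
  have hB : HasDerivAt (fun x : ℝ => 4 * b * x ^ 3 / h₁ ^ 4) (4 * b * (3 * y ^ 2) / h₁ ^ 4) y :=
    (h3.const_mul (4 * b)).div_const (h₁ ^ 4)
  exact (hA.sub hB).congr_deriv (by ring)

/-- **Step 1 holds** (polynomial calculus). [cite: Dou2026b, eq. (11) print p.5] -/
theorem step1_holds : Step1_steadyProfile := by
  intro ν a b h y hh
  rw [(hasDerivAt_deriv_profile a b h y).deriv]
  field_simp
  ring

/-! ## Step 9 holds — vacuously, by time-continuity (APPEND-ONLY D-0026 discharge, cell ns-claims,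
typist-2 g5, 2026-08-27)

The typist's flag made kernel-exact: a solution of the rendered class on `[0,∞)` is jointly smooth
(`IsRenderedSolutionOn.ns : IsClassicalNSSolutionOn (Ici 0) …`), so each time line `t ↦ u(x*,t)` is
continuous on `[0,∞)`; the two printed one-sided limits of (41) — «`|u(x*,t)| ≥ δ > 0` for `t < t*`» and
«`u(x*,t*) = 0`» — are therefore incompatible at any `t* > 0` (the left limit along `[0,t*)` of
`|u(x*,·)|` is `|u(x*,t*)| = 0 ≥ δ`). The typed implication holds because its antecedent is never met in
the class; nothing about a velocity jump is instantiated. Records-grade; the row's verdict (#67 C54b) is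
untouched. -/

/-- **Step 9 holds (vacuously in the typed class)** — §6.2 (41)–(42) p.12: along a solution of the
rendered problem on `[0,∞)` the premises «`δ ≤ |u(x*,t)|` on `[0,t*)`» and «`u(x*,t*) = 0`», `t* > 0`,
contradict the continuity of `t ↦ u(x*,t)` (classical solutions are jointly `C^∞` on `[0,∞) × ℝ³`), so the
conclusion is reached from `False`. [cite: Dou2026b, §6.2 eqs. (40)–(42) print p.11–12] -/
theorem step9_gradientBlowup_holds : Step9_gradientBlowup := by
  intro ν h Lx a b pdrop u p hsol tstar xstar htstar hδ hzero M
  obtain ⟨δ, hδpos, hge⟩ := hδ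
  exfalso
  -- the time line through `x*` is continuous within `[0,∞)` at `t*`
  have hcu : ContinuousOn (uncurry u) (Ici (0 : ℝ) ×ˢ (univ : Set (EuclideanSpace ℝ (Fin 3)))) :=
    hsol.ns.smooth_velocity.continuousOn
  have hcont : ContinuousWithinAt (fun s => u s xstar) (Ici 0) tstar := by
    have h1 : ContinuousWithinAt (fun s : ℝ => (s, xstar)) (Ici 0) tstar :=
      (continuous_id.prodMk continuous_const).continuousWithinAt
    have h2 : ContinuousWithinAt (uncurry u ∘ fun s : ℝ => (s, xstar)) (Ici 0) tstar :=
      ContinuousWithinAt.comp (hcu (tstar, xstar) ⟨mem_Ici.2 htstar.le, mem_univ _⟩) h1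
        fun s hs => ⟨hs, mem_univ _⟩
    exact h2
  have hcont' : ContinuousWithinAt (fun s => ‖u s xstar‖) (Ico 0 tstar) tstar :=
    hcont.norm.mono Ico_subset_Ici_self
  -- `t*` is a limit point of `[0,t*)`
  have hmem : tstar ∈ closure (Ico 0 tstar) := by
    rw [closure_Ico htstar.ne]
    exact right_mem_Icc.2 htstar.le
  haveI : (𝓝[Ico 0 tstar] tstar).NeBot := mem_closure_iff_nhdsWithin_neBot.1 hmem
  -- the left limit of `|u(x*,·)|` is `|u(x*,t*)| = 0`, yet it is eventually `≥ δ > 0`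
  have hev : ∀ᶠ s in 𝓝[Ico 0 tstar] tstar, δ ≤ ‖u s xstar‖ :=
    eventually_nhdsWithin_of_forall fun s hs => hge s hs
  have hle : δ ≤ ‖u tstar xstar‖ := ge_of_tendsto hcont'.tendsto hev
  rw [hzero, norm_zero] at hle
  exact absurd hle (not_le.2 hδpos)

end Literature.Claims.NS.Dou2026b

end

-- WHAT THIS IS NOT: not a claim about NS regularity or blow-up; not a claim about any author beyond the typed locator.
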